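import Literature.NumberTheory.FaltingsSerre.GSp4F2Hom
import HarnessLib

/-!
# The Faltings–Serre method after Brumer–Pacetti–Poor–Tornaría–Voight–Yuen, VII:
# `ι : S₆ ⥲ Sp₄(𝔽₂)` is an ISOMORPHISM — surjectivity and `#Sp₄(𝔽₂) = 720`, kernel-checked

[BPPTVY] = A. Brumer, A. Pacetti, C. Poor, G. Tornaría, J. Voight, D. S. Yuen, *On the paramodularity of
typical abelian surfaces*, Algebra & Number Theory **13**:5 (2019) 1145–1195 [cite: BrumerEtAl2019],
§5.1 p. 1173 (PRINTED numbering): "We have an isomorphism `ι : S₆ ⥲ Sp₄(𝔽₂)`, where `S₆` is the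
symmetric group on `6` letters, which we make explicit in the following manner … (5.1.1)"; and
(5.1.2): "`GSp₄(𝔽₂) = Sp₄(𝔽₂)`".

`GSp4F2.lean` constructs `ι`; `GSp4F2Hom.lean` proves it is an injective homomorphism with
`ι(σ)ᵀ J ι(σ) = J` (`J` = `antiId4`, the anti-identity Gram matrix).  THIS FILE completes the printed
statement: `GSp4F2.iota_surjective` — every `g ∈ M₄(𝔽₂)` with `gᵀ J g = J` is `ι(σ)` for some `σ ∈ S₆`;
`GSp4F2.card_Sp4F2` — `#Sp₄(𝔽₂) = 720`; `GSp4F2.mem_range_iotaGL` / `GSp4F2.iotaMulEquiv` — `ι` is a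
group isomorphism of `S₆` onto `Sp₄(𝔽₂) = {g ∈ GL₄(𝔽₂) : gᵀ J g = J}`.  Method (standard axioms, no
`native_decide`): the KERNEL COUNT `count_colCond` — the number of 4-tuples of vectors
`(c₀, c₁, c₂, c₃)` of `𝔽₂⁴` (bit-encoded by `Fin 16`, `vec16`) with Gram matrix `J` under the pairing
`⟨x,y⟩ = x₀y₃ + x₁y₂ + x₂y₁ + x₃y₀` is `720` (`decide +kernel`, four nested 16-fold sums) — bounds
`#{g : gᵀJg = J} ≤ 720` (the columns of such a `g` form such a tuple: `transpose_mul_J_mul_apply`),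
while `ι(S₆)` is a subset of size `#S₆ = 720` (`iota_injective`, `iota_symplectic`); so `ι(S₆)` is all
of `Sp₄(𝔽₂)` (`Finset.eq_of_subset_of_card_le`).  (Enumerating `M₄(𝔽₂)` through the `Fintype`
instance of `Fin 4 → Fin 4 → ZMod 2` does not reduce in the kernel — `Multiset.pi` is defined by
`Multiset.rec` —, whence the bit encoding; cell pub-paramod DIVERGENCE.md D-14.)
With this, "residual image `G ≤ GSp₄(𝔽₂)`" and "`G ≤ S₆` up to conjugacy" are interchangeable IN THE
KERNEL, as used throughout [BPPTVY, §5, Lemma 5.1.7, Lemma 5.2.1, Thm 5.3.1].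

## References
* [BPPTVY] ANT 13:5 (2019), §5.1 (5.1.1)–(5.1.2), p. 1173. [cite: BrumerEtAl2019]
-/

namespace Literature.NumberTheory.FaltingsSerre.GSp4F2

open Matrix Equiv Equiv.Perm Finset

/-! ### A. Bit-encoded vectors of `𝔽₂⁴` and the pairing of `J` -/

/-- The vector of `𝔽₂⁴` whose `k`-th coordinate is bit `k` of `r < 16`. [folklore] -/
def vec16 (r : Fin 16) : Fin 4 → ZMod 2 := fun k => if r.val.testBit k.val then 1 else 0

/-- The symplectic (equivalently, in characteristic `2`, symmetric) pairing with Gram matrix the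
anti-identity `J`: `⟨x,y⟩ = x₀y₃ + x₁y₂ + x₂y₁ + x₃y₀`. [cite: BrumerEtAl2019, §5.1 p. 1173] -/
def pairJ (x y : Fin 4 → ZMod 2) : ZMod 2 := x 0 * y 3 + x 1 * y 2 + x 2 * y 1 + x 3 * y 0

/-- Boolean test: the tuple `(c₀,c₁,c₂,c₃)` of bit-encoded vectors has Gram matrix `J` (the six
off-diagonal conditions; the diagonal ones are automatic in characteristic `2`). [cite: BrumerEtAl2019, §5.1 p. 1173] -/
def colCondB (c0 c1 c2 c3 : Fin 16) : Bool :=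
  pairJ (vec16 c0) (vec16 c3) == 1 && (pairJ (vec16 c1) (vec16 c2) == 1 &&
    (pairJ (vec16 c0) (vec16 c1) == 0 && (pairJ (vec16 c0) (vec16 c2) == 0 &&
      (pairJ (vec16 c1) (vec16 c3) == 0 && pairJ (vec16 c2) (vec16 c3) == 0))))

set_option maxRecDepth 200000 in
/-- KERNEL COUNT (`decide +kernel`, `16⁴ = 65536` cases): exactly `720` tuples of vectors of `𝔽₂⁴`
have Gram matrix `J`. [cite: BrumerEtAl2019, §5.1 p. 1173] -/
theorem count_colCond :
    (∑ c0 : Fin 16, ∑ c1 : Fin 16, ∑ c2 : Fin 16, ∑ c3 : Fin 16,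
      if colCondB c0 c1 c2 c3 = true then (1 : ℕ) else 0) = 720 := by
  decide +kernel

/-- `vec16` is injective (kernel check). [folklore] -/
theorem vec16_injective : Function.Injective vec16 := by
  have h : ∀ r s : Fin 16, vec16 r = vec16 s → r = s := by decide +kernel
  exact fun r s e => h r s e

/-- `vec16 : Fin 16 → 𝔽₂⁴` is a bijection (`16 = 2⁴`). [folklore] -/
theorem vec16_bijective : Function.Bijective vec16 := by
  rw [Fintype.bijective_iff_injective_and_card]
  exact ⟨vec16_injective, by simp⟩

/-- The `(i,j)` entry of `gᵀ J g` is the pairing of columns `i` and `j` of `g`. [cite: BrumerEtAl2019, (5.1.2) p. 1173] -/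
theorem transpose_mul_J_mul_apply (g : Matrix (Fin 4) (Fin 4) (ZMod 2)) (i j : Fin 4) :
    (gᵀ * antiId4 (ZMod 2) * g) i j = pairJ (fun k => g k i) (fun k => g k j) := by
  simp [Matrix.mul_apply, Fin.sum_univ_four, antiId4, pairJ, Matrix.transpose_apply]
  ring

/-- The matrix with columns `vec16 c₀, …, vec16 c₃`. [folklore] -/
def ofCols (c0 c1 c2 c3 : Fin 16) : Matrix (Fin 4) (Fin 4) (ZMod 2) :=
  Matrix.of fun i j => vec16 (![c0, c1, c2, c3] j) i

/-! ### B. `Sp₄(𝔽₂)` as a finite set; `#Sp₄(𝔽₂) ≤ 720` -/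

/-- `Sp₄(𝔽₂) = {g ∈ M₄(𝔽₂) : gᵀ J g = J}` as a `Finset` (such `g` are invertible: `det g = 1`). [cite: BrumerEtAl2019, (5.1.2) p. 1173] -/
def SpSet : Finset (Matrix (Fin 4) (Fin 4) (ZMod 2)) :=
  univ.filter fun g => gᵀ * antiId4 (ZMod 2) * g = antiId4 (ZMod 2)

/-- Unfolding lemma. [cite: BrumerEtAl2019, (5.1.2) p. 1173] -/
theorem mem_SpSet {g : Matrix (Fin 4) (Fin 4) (ZMod 2)} :
    g ∈ SpSet ↔ gᵀ * antiId4 (ZMod 2) * g = antiId4 (ZMod 2) := by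
  simp [SpSet]

/-- **`#Sp₄(𝔽₂) ≤ 720`**: the column map embeds `Sp₄(𝔽₂)` into the `720` tuples of `count_colCond`. [cite: BrumerEtAl2019, §5.1 p. 1173] -/
theorem card_SpSet_le : SpSet.card ≤ 720 := by
  set T : Finset (Fin 16 × Fin 16 × Fin 16 × Fin 16) :=
    univ.filter fun t => colCondB t.1 t.2.1 t.2.2.1 t.2.2.2 = true with hTdef
  have hT : T.card = 720 := by
    rw [hTdef, Finset.card_filter]
    simp only [Fintype.sum_prod_type]
    exact count_colCond
  have hsub : SpSet ⊆ T.image fun t => ofCols t.1 t.2.1 t.2.2.1 t.2.2.2 := by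
    intro g hg
    rw [mem_SpSet] at hg
    have e : ∀ i j : Fin 4, pairJ (fun k => g k i) (fun k => g k j) = antiId4 (ZMod 2) i j :=
      fun i j => by rw [← transpose_mul_J_mul_apply, hg]
    obtain ⟨c0, hc0⟩ := vec16_bijective.2 fun k => g k 0
    obtain ⟨c1, hc1⟩ := vec16_bijective.2 fun k => g k 1
    obtain ⟨c2, hc2⟩ := vec16_bijective.2 fun k => g k 2
    obtain ⟨c3, hc3⟩ := vec16_bijective.2 fun k => g k 3
    rw [Finset.mem_image]
    refine ⟨(c0, c1, c2, c3), ?_, ?_⟩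
    · rw [hTdef, Finset.mem_filter]
      refine ⟨mem_univ _, ?_⟩
      simp only [colCondB, hc0, hc1, hc2, hc3]
      rw [e 0 3, e 1 2, e 0 1, e 0 2, e 1 3, e 2 3]
      decide
    · ext i j
      simp only [ofCols, Matrix.of_apply]
      fin_cases j
      · simp [hc0]
      · simp [hc1]
      · simp [hc2]
      · simp [hc3]
  calc SpSet.card ≤ (T.image fun t => ofCols t.1 t.2.1 t.2.2.1 t.2.2.2).card := Finset.card_le_card hsub
    _ ≤ T.card := Finset.card_image_le
    _ = 720 := hT

/-! ### C. `ι(S₆) = Sp₄(𝔽₂)` -/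

/-- `ι(S₆) ⊆ Sp₄(𝔽₂)` as finite sets (`iota_symplectic`). [cite: BrumerEtAl2019, (5.1.1) p. 1173] -/
theorem image_iota_subset : (univ : Finset (Perm (Fin 6))).image iota ⊆ SpSet := by
  intro g hg
  rw [Finset.mem_image] at hg
  obtain ⟨σ, -, rfl⟩ := hg
  exact mem_SpSet.mpr (iota_symplectic σ)

/-- `#ι(S₆) = #S₆ = 720` (`iota_injective`). [cite: BrumerEtAl2019, §5.1 p. 1173] -/
theorem card_image_iota : ((univ : Finset (Perm (Fin 6))).image iota).card = 720 := by
  rw [Finset.card_image_of_injective _ (fun a b h => iota_injective a b h), Finset.card_univ,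
    Fintype.card_perm, Fintype.card_fin]
  rfl

/-- **`ι(S₆) = Sp₄(𝔽₂)`** as finite sets. [cite: BrumerEtAl2019, §5.1 p. 1173] -/
theorem image_iota_eq : (univ : Finset (Perm (Fin 6))).image iota = SpSet :=
  Finset.eq_of_subset_of_card_le image_iota_subset (by rw [card_image_iota]; exact card_SpSet_le)

/-- **`ι` is surjective onto `Sp₄(𝔽₂)`**: every `g ∈ M₄(𝔽₂)` with `gᵀ J g = J` is `ι(σ)` for some
`σ ∈ S₆`. [cite: BrumerEtAl2019, §5.1 (5.1.1) p. 1173] -/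
theorem iota_surjective (g : Matrix (Fin 4) (Fin 4) (ZMod 2))
    (hg : gᵀ * antiId4 (ZMod 2) * g = antiId4 (ZMod 2)) : ∃ σ : Perm (Fin 6), iota σ = g := by
  have hmem : g ∈ (univ : Finset (Perm (Fin 6))).image iota := by
    rw [image_iota_eq]; exact mem_SpSet.mpr hg
  obtain ⟨σ, -, h⟩ := Finset.mem_image.mp hmem
  exact ⟨σ, h⟩

/-- **`#Sp₄(𝔽₂) = 720`** (`= #S₆`). [cite: BrumerEtAl2019, §5.1 p. 1173] -/
theorem card_Sp4F2 : SpSet.card = 720 := by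
  rw [← image_iota_eq, card_image_iota]

/-- The range of `ι : S₆ → GL₄(𝔽₂)` is exactly `Sp₄(𝔽₂) = {g : gᵀ J g = J}`. [cite: BrumerEtAl2019, §5.1 (5.1.1)–(5.1.2) p. 1173] -/
theorem mem_range_iotaGL (g : GL (Fin 4) (ZMod 2)) :
    g ∈ iotaGL.range ↔
      (g : Matrix (Fin 4) (Fin 4) (ZMod 2))ᵀ * antiId4 (ZMod 2) * g = antiId4 (ZMod 2) := by
  constructor
  · rintro ⟨σ, rfl⟩
    exact iota_symplectic σ
  · intro h
    obtain ⟨σ, hσ⟩ := iota_surjective _ h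
    exact ⟨σ, Units.ext hσ⟩

/-- **`ι : S₆ ⥲ Sp₄(𝔽₂)`** — the printed isomorphism, as a `MulEquiv` of `S₆ = Perm (Fin 6)` onto the
range of `ι` in `GL₄(𝔽₂)`, which is `Sp₄(𝔽₂)` by `mem_range_iotaGL`. [cite: BrumerEtAl2019, §5.1 (5.1.1) p. 1173] -/
noncomputable def iotaMulEquiv : Perm (Fin 6) ≃* iotaGL.range :=
  MonoidHom.ofInjective iotaGL_injective

/-- `ι`, corestricted to the subtype `Sp₄(𝔽₂)`, is a bijection `S₆ → Sp₄(𝔽₂)`. [cite: BrumerEtAl2019, §5.1 (5.1.1) p. 1173] -/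
theorem iota_bijective_Sp :
    Function.Bijective fun σ : Perm (Fin 6) =>
      (⟨iota σ, iota_symplectic σ⟩ :
        {g : Matrix (Fin 4) (Fin 4) (ZMod 2) // gᵀ * antiId4 (ZMod 2) * g = antiId4 (ZMod 2)}) := by
  refine ⟨fun a b h => iota_injective a b (congrArg Subtype.val h), fun g => ?_⟩
  obtain ⟨σ, hσ⟩ := iota_surjective g.1 g.2
  exact ⟨σ, Subtype.ext hσ⟩

end Literature.NumberTheory.FaltingsSerre.GSp4F2
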